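import Mathlib

/-!
# Route `KPlusLogSqLaw`, crux `TropicalB` — Toeplitz sector: weak duality with a RANK FUNCTION ⇒ unique optimal assignment

HONEST FRAMING.  Helper toward the registered stubs `stub_tropThin` / `stub_tropFat` (crux `…Theses.KPlusLogSqLaw.TropicalB`, item
`stmt-ValiantsHypothesis-19771`; cell `pub-symmetroid`, seat `val-sym-trop-p4` (g23), 2026-08-29).  The abstract uniqueness mechanism of the
MORPH THEOREM (memo HOME/val-sym-trop-p4/g23/MORPH-THEOREM-g23.md §3): for an assignment profit `w a b` (value `a` at position `b`), a target
permutation `τ`, a symmetric integer potential `P` with `2·w a b ≤ P a + P b` everywhere and equality along `τ`, and a RANK `R` such that every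
tight non-`τ` pair `(a, b)` has `R (τ⁻¹ a) < R b`, the permutation `τ` is the UNIQUE maximiser of `Σ_b w (σ b) b` — weak LP duality gives `≤`,
and an optimal `σ` is tight everywhere, so a tight position `b` with `σ b ≠ τ b` of minimal rank produces another one of smaller rank
(`τ⁻¹ (σ b)`), contradiction.  This replaces the tight-graph peeling of the memo by one inequality per rung.  Definition-free; used by
`…ToeplitzMorphMember`.  Nothing here bounds `Φ_Toep`; `ConjectureTPoly` / `TropicalB` stay OPEN; nothing on `MatrixDescartes` or `VP ≠ VNP`.
-/

set_option linter.dupNamespace false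
set_option autoImplicit false

namespace Summit.ValiantsHypothesis.ValiantsHypothesis.Theorems.KPlusLogSqLaw.Toeplitz

open scoped BigOperators
open Finset

/-- **Rank lemma.**  If every position of `σ` is tight and every tight pair `(a, b)` is either the `τ`-pair or has
`R (τ⁻¹ a) < R b`, then `σ = τ`. [folklore] -/
theorem perm_eq_of_tight_rank {m : ℕ} (T : Fin m → Fin m → Prop) (τ σ : Equiv.Perm (Fin m)) (R : Fin m → ℤ)
    (hrank : ∀ a b, T a b → a = τ b ∨ R (τ.symm a) < R b) (hσ : ∀ b, T (σ b) b) : σ = τ := by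
  by_contra hne
  have hS : (univ.filter fun b : Fin m => σ b ≠ τ b).Nonempty := by
    by_contra hemp
    rw [Finset.not_nonempty_iff_eq_empty, Finset.filter_eq_empty_iff] at hemp
    exact hne (Equiv.ext fun b => by simpa using hemp (mem_univ b))
  obtain ⟨b₀, hb₀, hmin⟩ := exists_min_image _ R hS
  have hb₀' : σ b₀ ≠ τ b₀ := (mem_filter.mp hb₀).2
  rcases hrank (σ b₀) b₀ (hσ b₀) with h | h
  · exact hb₀' h
  · set b' := τ.symm (σ b₀) with hb'
    have hτb' : τ b' = σ b₀ := by simp [hb']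
    have hb'S : b' ∈ univ.filter fun b : Fin m => σ b ≠ τ b := by
      refine mem_filter.mpr ⟨mem_univ _, fun heq => ?_⟩
      have hbb : b' = b₀ := σ.injective (heq.trans hτb')
      exact hb₀' (by rw [← hbb]; exact heq)
    have := hmin b' hb'S
    omega

/-- **Weak duality with a rank function ⇒ unique optimum.**  Profit `w a b` of assigning value `a` to position `b`; symmetric
potential `P` with `2 w a b ≤ P a + P b`, tight along `τ`; rank `R` with `R (τ⁻¹ a) < R b` on every other tight pair.  Then every
`σ ≠ τ` has strictly smaller total profit. [folklore] -/
theorem unique_opt_of_potential_rank {m : ℕ} (w : Fin m → Fin m → ℤ) (τ : Equiv.Perm (Fin m)) (P R : Fin m → ℤ)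
    (hfeas : ∀ a b, 2 * w a b ≤ P a + P b) (htight : ∀ b, 2 * w (τ b) b = P (τ b) + P b)
    (hrank : ∀ a b, 2 * w a b = P a + P b → a = τ b ∨ R (τ.symm a) < R b) :
    ∀ σ : Equiv.Perm (Fin m), σ ≠ τ → ∑ b, w (σ b) b < ∑ b, w (τ b) b := by
  intro σ hσ
  have hτsum : 2 * ∑ b, w (τ b) b = ∑ a, P a + ∑ b, P b := by
    rw [mul_sum, sum_congr rfl (fun b _ => htight b), sum_add_distrib, Equiv.sum_comp τ P]
  have h1 : ∑ b, (P (σ b) + P b - 2 * w (σ b) b) = ∑ b, P (σ b) + ∑ b, P b - ∑ b, 2 * w (σ b) b := by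
    rw [sum_sub_distrib, sum_add_distrib]
  have h2 : ∑ b, P (σ b) = ∑ a, P a := Equiv.sum_comp σ P
  have h3 : ∑ b, 2 * w (σ b) b = 2 * ∑ b, w (σ b) b := by rw [mul_sum]
  have hnn : ∀ b ∈ univ, 0 ≤ P (σ b) + P b - 2 * w (σ b) b := fun b _ => by linarith [hfeas (σ b) b]
  have hslack : 0 ≤ ∑ b, (P (σ b) + P b - 2 * w (σ b) b) := sum_nonneg hnn
  by_contra hge
  push Not at hge
  have hzero : ∑ b, (P (σ b) + P b - 2 * w (σ b) b) = 0 := by linarith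
  have hall := (sum_eq_zero_iff_of_nonneg hnn).mp hzero
  have hT : ∀ b, 2 * w (σ b) b = P (σ b) + P b := fun b => by linarith [hall b (mem_univ b)]
  exact hσ (perm_eq_of_tight_rank (fun a b => 2 * w a b = P a + P b) τ σ R hrank hT)

end Summit.ValiantsHypothesis.ValiantsHypothesis.Theorems.KPlusLogSqLaw.Toeplitz
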